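import Summits.HubbardSuperconductivity.HubbardSuperconductivity.Theorems.AnisotropyChordTransferFibre3FinX5Eval

/-!
# Route `AnisotropyChord` / H0 rotor rung: FIN per-`L` GM₃ (X5) — the row-C certificate with the two large site sums as INPUTS (`L ≥ 43`)

At `L ≥ 43` the row-C cell fact `xcCellAnyA0` (profile / gradient tables from two literal Green point wedges + g5's six real-space sums)
exceeds the kernel work ceiling of one `decide` (≈285 s-equivalent at `L = 47`; measured 236 s at `L = 36`, `∝ L³`).  THIS FILE splits it
WITHOUT touching the soundness chain: `xcObjS` / `xcCellOKS` / `xcCellOKAS` are g5's `xcObjT` / `xcCellOKT` / X5's `xcCellOKA` with the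
gradient-correlation sum `Ψ = xcPsi` and the contact-shell row sum `xcRowSum` replaced by GIVEN intervals, and ★ `xcObjS_eq`, ★ `xcCellOKS_eq`,
★ `xcCellOKAS_eq` say that feeding the recomputed sums gives back the original programs (`rfl`).  A cell is then certified by THREE kernel
facts — `xcPsi … = litΨ`, `xcRowSum … = litR` (each one `decide`), and the final check on the literals — which rewrite to the single fact
`xcCellAnyA0 … = true` consumed by `…FinX5SoundB.gm3_of_gmCheck5`.
Prover seat `hubbard-h0-rotor-p3` g8; helper for piece A = stmt-HubbardSuperconductivity-23918 of rung 19089 (`--supports`, helper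
class).  WHAT THIS IS NOT: nothing here proves superconductivity in the Hubbard model (rotor TARGET as worded stays FALSE, g15 verdict);
evaluator plumbing for the FIN certificates of ONE conditional reduction.  Tree imports only; no sorry, no new axioms.
-/

set_option linter.dupNamespace false
set_option autoImplicit false

namespace Summit.HubbardSuperconductivity.HubbardSuperconductivity.Theorems.AnisotropyChord.Transfer.Fibre3

namespace FinXB

open Hole2 FinCell

/-- g5's row-C objects with `Ψ` and the row sum given. -/
def xcObjS (L : ℕ) (S : XBScal) (tb : ℤ × ℤ) (ft gx : List (List Iv)) (psi rows : Iv) : XCObj :=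
  let V : ℕ := L * L
  let ct := cosTab L
  let Mz := xcM L ft
  let M : Iv := ipt Mz
  let M2 := imul M M
  let fnn2 := isqP (getF ft 1 0)
  let Q0 := xcQ0 L ft
  let Rb := xcRbar L gx
  let X := xcX L gx ct
  let Gam := iscale 2 (imul M2 (iadd Rb (iscale 2 fnn2)))
  let inner := imul (iscale 4 (imul Q0 X)) (imul Gam Rb)
  let chi := iadd (iadd (iscale 4 (imul (imul S.eps1 Q0) X))
      (imul (imul S.eps1 Rb) (iadd Gam (iscale 2 (imul fnn2 M2)))))
      (iscale 2 (imul S.eps1 (isqrt inner)))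
  let nhi := iadd (idivn (iscale 9 (imul M2 psi)) 4) (iscale 12 rows)
  { M := Mz, chi := chi, nhi := nhi, tlo := tb.1, thi := tb.2, eta := idivn (iscale V S.lam) 4 }

/-- ★ with the recomputed sums, `xcObjS` is `xcObjT`. [folklore] -/
theorem xcObjS_eq (L : ℕ) (S : XBScal) (tb : ℤ × ℤ) (ft gx : List (List Iv)) :
    xcObjS L S tb ft gx (xcPsi L gx) (xcRowSum L ft gx) = xcObjT L S tb ft gx := rfl

/-- g5's row-C certificate on given tables with `Ψ` and the row sum given. -/
def xcCellOKS (L : ℕ) (la lb : ℤ) (bn bd : ℕ) (tb : ℤ × ℤ) (ft gx : List (List Iv)) (psi rows : Iv) : Bool :=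
  let S := xbScal L la lb (gresCellTab L (cosTab L) la lb)
  let C := xcObjS L S tb ft gx psi rows
  groundCellCheck L la lb && xbScalOK L la lb && decide (0 < bd) && xcMok L ft C.M && decide (0 ≤ C.tlo) &&
    decide (C.thi ≤ 2 * S.eps1.1) && decide (0 ≤ C.eta.1) && decide (sqSum C ≤ rhsLo L S C bn bd)

/-- ★ with the recomputed sums, `xcCellOKS` is `xcCellOKT`. [folklore] -/
theorem xcCellOKS_eq (L : ℕ) (la lb : ℤ) (bn bd : ℕ) (tb : ℤ × ℤ) (ft gx : List (List Iv)) :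
    xcCellOKS L la lb bn bd tb ft gx (xcPsi L gx) (xcRowSum L ft gx) = xcCellOKT L la lb bn bd tb ft gx := rfl

/-- the X5 row-C cell certificate on the point wedges with `Ψ` and the row sum given. -/
def xcCellOKAS (L : ℕ) (la lb : ℤ) (bn bd : ℕ) (tb : ℤ × ℤ) (wLo wHi : List (List Iv)) (psi rows : Iv) : Bool :=
  let ft := fTabA L la lb wLo wHi
  denCellPos L (cosTab L) la la && denCellPos L (cosTab L) lb lb && decide (0 < la) &&
    xcCellOKS L la lb bn bd tb ft (gTabA L la lb wLo wHi ft) psi rows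

/-- ★ with the recomputed sums, `xcCellOKAS` is `xcCellOKA` (so the three kernel facts of a split cell rewrite to the single fact
`xcCellAnyA0 … = true`). [folklore] -/
theorem xcCellOKAS_eq (L : ℕ) (la lb : ℤ) (bn bd : ℕ) (tb : ℤ × ℤ) (wLo wHi : List (List Iv)) :
    xcCellOKAS L la lb bn bd tb wLo wHi (xcPsi L (gTabA L la lb wLo wHi (fTabA L la lb wLo wHi)))
      (xcRowSum L (fTabA L la lb wLo wHi) (gTabA L la lb wLo wHi (fTabA L la lb wLo wHi))) = xcCellOKA L la lb bn bd tb wLo wHi := rfl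

/-- the cell in cover form with the sums given: the vacuous branches of `xcCellAnyTA`, or `xcCellOKAS`. -/
def xcCellAnyTAS (L : ℕ) (d1 : ℚ) (bd : ℕ) (la lb : ℤ) (bn : ℕ) (tb : ℤ × ℤ) (wLo wHi : List (List Iv)) (psi rows : Iv) : Bool :=
  (denCellPos L (cosTab L) la lb && decide ((numIv L la lb).2 < 0) && decide (0 ≤ (G0Iv L la lb).1)) ||
  (groundCellCheck L la lb &&
    (decide ((deltaIv L la lb).2 < 0) || decide (d1 * (D : ℚ) < (((deltaIv L la lb).1 : ℤ) : ℚ)))) ||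
  xcCellOKAS L la lb bn bd tb wLo wHi psi rows

/-- ★ with the recomputed sums, `xcCellAnyTAS` is `xcCellAnyTA`. [folklore] -/
theorem xcCellAnyTAS_eq (L : ℕ) (d1 : ℚ) (bd : ℕ) (la lb : ℤ) (bn : ℕ) (tb : ℤ × ℤ) (wLo wHi : List (List Iv)) :
    xcCellAnyTAS L d1 bd la lb bn tb wLo wHi (xcPsi L (gTabA L la lb wLo wHi (fTabA L la lb wLo wHi)))
      (xcRowSum L (fTabA L la lb wLo wHi) (gTabA L la lb wLo wHi (fTabA L la lb wLo wHi)))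
      = xcCellAnyTA L d1 bd la lb bn tb wLo wHi := rfl

end FinXB

end Summit.HubbardSuperconductivity.HubbardSuperconductivity.Theorems.AnisotropyChord.Transfer.Fibre3
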